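import Summits.Langlands.Langlands.Theses.IrreducibilityBySelfDuality

/-!
# Disproof of `PairLBoundaryJS` (crux stmt-Langlands-13622) — findings: NO KILL; the crux is a
# printed theorem (Arthur–Clozel (2.2) = Jacquet–Shalika II Prop. 3.6 + Shahidi) transcribed verbatim;
# load-bearing: the exclusion `¬ X` (pole) and the Satake linkage to cuspidal data (both CERTIFIED
# below at rank `(1,1)`); decoration: `0 < n`, `0 < m`, `∃ S₀`, `s₀.re = 1`; only `(1,1)` is inhabitable.

Standing disprover's work file (cdisprove, cycle 1, refuter-cdisprove-stmt-Langlands-13622-0), for the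
provers / planners of crux `Summit.Langlands.Langlands.Theses.IrreducibilityBySelfDuality.PairLBoundaryJS`.
Prose lives in docstrings; everything named `theorem` is kernel-checked (no `sorry` in this file).

## 0. Verdict and WHY IT RESISTS

* The crux is, symbol for symbol, the Literature named fact
  `JacquetShalika1981_partialPairL_boundary_repData` (`Iff.rfl`, landed p78245): Arthur–Clozel, Ann. of
  Math. Stud. 120, Ch. 3 §2 (2.2), for cuspidal Borel–Jacquet data on `GL_n × GL_m` over a number field.
  Mathematically TRUE (JS II Prop. 3.6: continuity of `L^S` on `Re s = 1` off `X`; Shahidi 1981: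
  non-vanishing on `Re s = 1`). A refutation could only come from a TRANSCRIPTION slip.
* INHABITATION BARRIER (why no unconditional `¬ PairLBoundaryJS` is in sight even if a higher-rank
  slip existed): `CuspidalAutomorphicRepData n F hF = {π : AutomorphicRepData (gl datum) //
  π.W ≤ cuspFormsGL}` with `π.W' < π.W`, i.e. it packages a NON-ZERO cusp form on `GL_n(𝔸_F)`. The tree
  CONSTRUCTS such data only for `n = 1` (Hecke characters,
  `exists_cuspidal_glOne_hasSatakeParamAt_valueAtUniformizer`). A proof of `¬ ∀ n m F … π π', …` must
  exhibit `π`, so today it lives in rank `(1,1)` — and the `(1,1)` slice is a THEOREM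
  (`JacquetShalika1981_partialPairL_boundary_repData_one_one`, p84372; `PairLBoundaryJS_one_one`).
  WITHIN REACH but not done (and useless for a kill): rank `2` over `ℚ` from Ramanujan's `Δ` — Mathlib
  has `CuspForm.discriminant`, `CuspForm.rank_eq_one_of_weight_eq_twelve` (so `Δ` is an eigenvector of
  every endomorphism of `S₁₂(1)`, in particular of the tree's `heckeT`), and the tree has the adelic
  lift `exists_cuspidalAutomorphicRepData_satake_of_eigenform` (`NewformAutomorphicRepSatake`) producing
  a `CuspidalAutomorphicRepData 2 ℚ hcpt` with Satake polynomials `X² - τ(p)p^{-11/2}X + 1`; missing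
  glue: `Gamma1 1` vs `𝒮ℒ` transport and a stable cusp space `V ∋ φ_Δ`. On such a `π_Δ` the slices
  `(2,2)`, `(2,1)` of the crux are Rankin (1939) / Hecke and Gelbart–Jacquet–Shahidi (`L(s, Δ × Δ) =
  ζ(s)L(s, Sym² Δ)` regular and non-zero on `Re s = 1`, `s ≠ 1`) — TRUE, so no kill there either; no
  Bianchi / higher-rank cusp form is constructible at all (cf. `ArtinWeightRealisationLevel/Negative/ZeroSector`).
* NORMALISATION AUDIT of `X` (the planner's only declared risk, "q_v vs q_v⁻¹"): with the tree's
  `HasSatakeParamAt` (eigenvalue of `T_{v,i} = [K diag(ϖ^{(i)},1^{(n-i)}) K]` equal to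
  `q^{i(n-i)/2} e_i(α)`, Shimura/Tamagawa), `|·|^u` has Satake parameter `q_v^{-u}` and the
  contragredient has `α⁻¹`; hence `X : q_w^{1-s₀} α_w = β_w⁻¹ (a.e. w)` reads
  `π'_w ≅ (π̃ ⊗ |det|^{1-s₀})_w`, and `L(s, π × π̃ ⊗ |det|^{u}) = L(s+u, π × π̃)` has its pole at
  `s = 1 - u = s₀` — `X` is exactly the pole locus, in every rank; "a.e. `w`" ⟺ global `≅` is strong
  multiplicity one (JS II 4.4). At `(1,1)` this is validated by the tree's own proof; the tightness
  theorem `pairLBoundaryJS_false_without_X` below checks the sign at `s₀ = 1` once more (`α β = 1`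
  gives the pole of `ζ_ℚ^S`).

## (a) Load-bearing analysis (theorems) — LANDED p99684 (accepted 2026-08-16T11:53Z) as
## `Summits/Langlands/Langlands/Theorems/PairLBoundaryJS/Negative/LoadBearing.lean`
## (namespace `Summit.Langlands.Langlands.Theorems.PairLBoundaryJS.Negative`, statements inlined there;
## ideators / planners / the lead may `import Summits.Langlands.Langlands.Theorems.PairLBoundaryJS.Negative.LoadBearing`)

* `PairLBoundaryJSWithoutX` / `pairLBoundaryJS_false_without_X` — drop the exclusion `¬ X`: FALSE at
  `n = m = 1`, `F = ℚ`, `π = π' =` the trivial character, `α = β = 1`, `s₀ = 1`: the function is the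
  partial Riemann zeta `ζ^S(s)`, which has NO finite limit at `1⁺` (`(s-1)ζ^S(s) → c' ≠ 0`, tree theorem
  `tendsto_sub_one_mul_tprod_eulerFactor_one_numberField`). Any proof must use `¬ X`.
* `PairLBoundaryJSWithoutSatakeLink` / `pairLBoundaryJS_false_without_satakeLink` — keep every
  hypothesis on the families `α, β` that the data would give a.e. (cardinality `n`, `m`; unitary
  products) but drop the link `HasSatakeParamAt` to cuspidal data: FALSE at `n = m = 1`, `F = ℚ`,
  `α_w = {-1}` (the "Liouville family"), `β_w = {1}`, `s₀ = 1` (off `X`: `-1 ≠ 1` at every `w`): the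
  function is `∏_{p ∉ S} (1 + p^{-s})⁻¹ = ζ^S(2s) / ζ^S(s) → 0`, a ZERO on the boundary. So the
  NON-VANISHING half (Shahidi) is genuinely automorphic input, not a property of unitary Euler products;
  dually `λ_w = +1` off a thin infinite set, `-1` on it, makes the FINITENESS half fail off `X`
  (informal; not formalised).

## (b) Hypothesis-minimality remarks (informal, for the planner; no item is misstated)

* `0 < n`, `0 < m`: decoration — in rank `0` a Satake parameter has `card = 0`, the pair polynomial is
  `1`, the product is `≡ 1`, the conclusion holds with `c = 1` (and `X` is moot).
* `∃ S₀`: removable in substance — the hypotheses `HasSatakeParamAt w (α w)` for `w ∉ S` already force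
  `S ⊇` ramified places, and finitely many unramified unitary-generic Euler factors have neither zero
  nor pole on `Re s ≥ 1` (`|a| < q^{1/2}`, JS (2.5)); the tree keeps `S₀` for the `L²` normalisation.
* `s₀.re = 1`: removable given the unitarity clauses — for `Re s₀ < 1` the filter
  `𝓝[{1 < re}] s₀ = ⊥`; for `Re s₀ > 1` the value of the absolutely convergent product is the limit
  and is `≠ 0`; and `X` fails automatically off the line (`‖q^{n(1-s₀)}‖ = 1` forces `Re s₀ = 1`).
* unitarity `‖∏ α_w‖ = 1`: AS TYPED not load-bearing at `(1,1)` — for a non-unitary character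
  `|·|^{-δ}` the Euler product is not `Multipliable` near `1⁺` and Mathlib's `tprod` returns the junk
  value `1`, so the conclusion holds with `c = 1`; for `|·|^{+δ}` the limit is the honest value at
  `Re = 1 + δ`. (The clause is of course needed for the MEANING; provers normalise through
  `CuspidalAutomorphicRepData.exists_satake_eq_cpow_mul_L2_holds`.)
* `S.Finite`: load-bearing in substance — `S = {p : cos(t log p) < 0}` makes `|ζ^{S}(σ + it)| → ∞`
  (half the primes), off `X`; not formalised (needs prime-distribution input).

## (c)/(d) Line `Sketch` (lead prover-line-stmt-Langlands-13622-0) — targets: none broken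

`PairLBoundaryJS_of := PairLBoundaryJS_of_moeglinWaldspurger_of_isOrtho hA hC hB` — joint sufficiency
is KERNEL-CHECKED (p81600), no gap can hide in the composition. The three crux-sized stubs are the
Literature facts `MoeglinWaldspurger1989_partialPairL_entire_of_rank_ne`, `…_of_eq_conj` and the
orthogonal-pair continuation; at `n = 1` they are consistent (the automorphic quotient is
`GL_n(K) A_G \ GL_n(𝔸)`, so `P ⟂ P'.conj ⟺ ψψ' ≠ 1` with no `|·|^{it}` freedom, and `L^S(s, ψψ')` is
then entire; `s(s-1)ζ_K^S(s)` is entire), and in rank `≥ 2` no `CuspidalAutomorphicRepGL` datum is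
constructible either — no stub kill is possible; the four analytic micro-stubs are Mathlib-level
truths (three already landed). payload.stuck_stubs = [] this cycle.
-/

noncomputable section

-- `Summit.Langlands.Langlands.…` trips `dupNamespace` (D-0017 layout).
set_option linter.dupNamespace false

open scoped Topology
open NumberField IsDedekindDomain MeasureTheory Filter
open Literature.NumberTheory.Automorphic AdelicGroupData
open Literature.NumberTheory.GaloisRepresentations

namespace Summit.Langlands.Langlands.Cruxes.PairLBoundaryJS.Disproof

/-! ## (a) Load-bearing analysis -/

/-- `PairLBoundaryJS` with the exclusion `¬ X` DROPPED (everything else verbatim): "for all cuspidal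
data and unitary Satake families, `L^S(s, α × β)` has a finite non-zero limit at EVERY `s₀` with
`Re s₀ = 1`". Refuted below (`pairLBoundaryJS_false_without_X`). -/
def PairLBoundaryJSWithoutX : Prop :=
  ∀ (n m : ℕ) (F : Type) [Field F] [NumberField F] (hF : isCompact_glFiniteIntegralLevel n F)
    (hF' : isCompact_glFiniteIntegralLevel m F), 0 < n → 0 < m →
    ∀ (π : CuspidalAutomorphicRepData n F hF) (π' : CuspidalAutomorphicRepData m F hF'),
    ∃ S₀ : Set (HeightOneSpectrum (𝓞 F)), S₀.Finite ∧
      ∀ {S : Set (HeightOneSpectrum (𝓞 F))}, S.Finite → S₀ ⊆ S →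
      ∀ {α β : HeightOneSpectrum (𝓞 F) → Multiset ℂ},
        (∀ w ∉ S, π.1.HasSatakeParamAt w (α w)) → (∀ w ∉ S, π'.1.HasSatakeParamAt w (β w)) →
        (∀ w ∉ S, ‖(α w).prod‖ = 1) → (∀ w ∉ S, ‖(β w).prod‖ = 1) →
        ∀ {s₀ : ℂ}, s₀.re = 1 →
          ∃ c : ℂ, c ≠ 0 ∧ Tendsto (fun s : ℂ =>
            ∏' w : {w : HeightOneSpectrum (𝓞 F) // w ∉ S},
              ((satakePairPolynomial (α w.1) (β w.1)).eval ((w.1.residueCard : ℂ) ^ (-s)))⁻¹)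
            (𝓝[{s : ℂ | 1 < s.re}] s₀) (𝓝 c)

/-- The trivial character of `GL_1(𝔸_F)` as a cuspidal Borel–Jacquet datum with Satake parameter
`{1}` at all but finitely many places (tree: `exists_cuspidal_glOne_hasSatakeParamAt_valueAtUniformizer`
with `θ = 1`). -/
theorem exists_trivial_glOne (F : Type) [Field F] [NumberField F]
    (h1 : isCompact_glFiniteIntegralLevel 1 F) :
    ∃ τ : CuspidalAutomorphicRepData 1 F h1,
      ∀ᶠ w : HeightOneSpectrum (𝓞 F) in cofinite, τ.1.HasSatakeParamAt w {1} := by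
  obtain ⟨τ, hτ⟩ := exists_cuspidal_glOne_hasSatakeParamAt_valueAtUniformizer h1 (1 : HeckeCharacter F)
  refine ⟨τ, ?_⟩
  filter_upwards [hτ] with w hw
  have h1v : (1 : HeckeCharacter F).valueAtUniformizer w = 1 := by
    rw [HeckeCharacter.valueAtUniformizer, HeckeCharacter.localComponent_apply,
      HeckeCharacter.one_apply, Units.val_one]
  rwa [h1v] at hw

/-- The `(1,1)` Euler factor of two singleton families: `(1 - a b x)`. -/
theorem eval_pair_singleton (a b x : ℂ) :
    (satakePairPolynomial {a} {b}).eval x = 1 - a * b * x :=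
  eval_satakePairPolynomial_singleton a b x

/-- **`¬ X` is load-bearing (tightness of the exclusion).** Witness: `n = m = 1`, `F = ℚ`,
`π = π' = 1` (trivial character), `α = β = {1}`, `s₀ = 1 ∈ X`: the partial product is `ζ_ℚ^S(s)`,
and `(s - 1) ζ_ℚ^S(s) → c' ≠ 0` (`tendsto_sub_one_mul_tprod_eulerFactor_one_numberField`), so no
finite limit `c` exists (else `(s-1)·L → 0`). Any proof of the crux must use `¬ X`; and the typed
`X` does contain this pole (`q_w^{1-1}·1 = 1⁻¹`). -/
theorem pairLBoundaryJS_false_without_X : ¬ PairLBoundaryJSWithoutX := by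
  intro h
  have h1 : isCompact_glFiniteIntegralLevel 1 ℚ := isCompact_glFiniteIntegralLevel_holds 1 ℚ
  obtain ⟨τ, hτ⟩ := exists_trivial_glOne ℚ h1
  obtain ⟨S₀, hS₀, hmain⟩ := h 1 1 ℚ h1 h1 one_pos one_pos τ τ
  have hE : {w : HeightOneSpectrum (𝓞 ℚ) | ¬ τ.1.HasSatakeParamAt w {1}}.Finite :=
    Filter.eventually_cofinite.1 hτ
  obtain ⟨S, hSdef⟩ : ∃ S : Set (HeightOneSpectrum (𝓞 ℚ)),
      S = S₀ ∪ {w | ¬ τ.1.HasSatakeParamAt w {1}} := ⟨_, rfl⟩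
  have hS : S.Finite := hSdef ▸ hS₀.union hE
  have hS₀S : S₀ ⊆ S := hSdef ▸ Set.subset_union_left
  have hα : ∀ w ∉ S, τ.1.HasSatakeParamAt w ((fun _ => ({1} : Multiset ℂ)) w) := by
    intro w hw
    by_contra hno
    exact hw (hSdef ▸ Or.inr hno)
  have hu : ∀ w ∉ S, ‖((fun _ => ({1} : Multiset ℂ)) w).prod‖ = 1 := by
    intro w _
    simp
  obtain ⟨c, -, hlim⟩ := hmain hS hS₀S hα hα hu hu Complex.one_re
  have hfun : (fun s : ℂ => ∏' w : {w : HeightOneSpectrum (𝓞 ℚ) // w ∉ S},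
      ((satakePairPolynomial ((fun _ => ({1} : Multiset ℂ)) w.1)
        ((fun _ => ({1} : Multiset ℂ)) w.1)).eval ((w.1.residueCard : ℂ) ^ (-s)))⁻¹) =
      fun s : ℂ => ∏' w : {w : HeightOneSpectrum (𝓞 ℚ) // w ∉ S},
        (1 - ((w.1.residueCard : ℂ) ^ (-s)))⁻¹ := by
    funext s
    refine tprod_congr fun w => ?_
    rw [eval_pair_singleton, one_mul, one_mul]
  rw [hfun] at hlim
  obtain ⟨c', hc', hpole⟩ := tendsto_sub_one_mul_tprod_eulerFactor_one_numberField (K := ℚ) hS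
  have h0 := tendsto_sub_one_nhdsWithin_one_lt_re.mul hlim
  rw [zero_mul] at h0
  exact hc' (tendsto_nhds_unique hpole h0)

/-- `PairLBoundaryJS` with the LINK TO CUSPIDAL DATA dropped: the families `α`, `β` keep everything
`HasSatakeParamAt` would give them almost everywhere (cardinalities `n`, `m`) and the unitarity
clauses, but are no longer Satake parameters of anything. Refuted below
(`pairLBoundaryJS_false_without_satakeLink`). -/
def PairLBoundaryJSWithoutSatakeLink : Prop :=
  ∀ (n m : ℕ) (F : Type) [Field F] [NumberField F], 0 < n → 0 < m →
    ∃ S₀ : Set (HeightOneSpectrum (𝓞 F)), S₀.Finite ∧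
      ∀ {S : Set (HeightOneSpectrum (𝓞 F))}, S.Finite → S₀ ⊆ S →
      ∀ {α β : HeightOneSpectrum (𝓞 F) → Multiset ℂ},
        (∀ w ∉ S, Multiset.card (α w) = n) → (∀ w ∉ S, Multiset.card (β w) = m) →
        (∀ w ∉ S, ‖(α w).prod‖ = 1) → (∀ w ∉ S, ‖(β w).prod‖ = 1) →
        ∀ {s₀ : ℂ}, s₀.re = 1 →
          ¬ (n = m ∧ ∀ᶠ w in cofinite,
              (α w).map ((((w.residueCard : ℂ) ^ (1 - s₀))) * ·) = (β w).map (·⁻¹)) →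
          ∃ c : ℂ, c ≠ 0 ∧ Tendsto (fun s : ℂ =>
            ∏' w : {w : HeightOneSpectrum (𝓞 F) // w ∉ S},
              ((satakePairPolynomial (α w.1) (β w.1)).eval ((w.1.residueCard : ℂ) ^ (-s)))⁻¹)
            (𝓝[{s : ℂ | 1 < s.re}] s₀) (𝓝 c)

/-- `∏'_{w ∉ S} (1 + q_w^{-s})⁻¹ · ζ_ℚ^S(s) = ζ_ℚ^S(2s)` for `Re s > 1` (both products multipliable:
`multipliable_inv_eval_satakePairPolynomial_of_rpow`, `multipliable_inv_one_sub_residueCard_cpow_neg`). -/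
theorem tprod_onePlus_mul_zeta {F : Type} [Field F] [NumberField F]
    (S : Set (HeightOneSpectrum (𝓞 F))) {s : ℂ} (hs : 1 < s.re) :
    (∏' w : {w : HeightOneSpectrum (𝓞 F) // w ∉ S}, (1 + ((w.1.residueCard : ℂ) ^ (-s)))⁻¹) *
      (∏' w : {w : HeightOneSpectrum (𝓞 F) // w ∉ S}, (1 - ((w.1.residueCard : ℂ) ^ (-s)))⁻¹) =
      ∏' w : {w : HeightOneSpectrum (𝓞 F) // w ∉ S},
        (1 - ((w.1.residueCard : ℂ) ^ (-(2 * s))))⁻¹ := by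
  have hmulP : Multipliable fun w : {w : HeightOneSpectrum (𝓞 F) // w ∉ S} =>
      (1 + ((w.1.residueCard : ℂ) ^ (-s)))⁻¹ := by
    have h := multipliable_inv_eval_satakePairPolynomial_of_rpow (S := S)
      (α := fun _ => ({-1} : Multiset ℂ)) (β := fun _ => ({1} : Multiset ℂ)) (N := 1) (M := 1)
      (B := 0) (B' := 0)
      (fun v _ a ha => by
        rw [Multiset.mem_singleton] at ha
        rw [ha, norm_neg, norm_one, Real.rpow_zero])
      (fun v _ b hb => by
        rw [Multiset.mem_singleton] at hb
        rw [hb, norm_one, Real.rpow_zero])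
      (fun v _ => by simp) (fun v _ => by simp) (s := s) (by simpa using hs)
    refine h.congr fun w => ?_
    rw [eval_pair_singleton]
    ring_nf
  have hmulZ := multipliable_inv_one_sub_residueCard_cpow_neg (K := F) S hs
  rw [← hmulP.tprod_mul hmulZ]
  refine tprod_congr fun w => ?_
  have hq : (w.1.residueCard : ℂ) ≠ 0 :=
    Nat.cast_ne_zero.2 (ne_of_gt (lt_trans zero_lt_one w.1.one_lt_residueCard))
  have hsq : (w.1.residueCard : ℂ) ^ (-(2 * s)) =
      ((w.1.residueCard : ℂ) ^ (-s)) * ((w.1.residueCard : ℂ) ^ (-s)) := by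
    rw [← Complex.cpow_add _ _ hq]
    ring_nf
  rw [hsq, ← mul_inv]
  congr 1
  ring

/-- **The Satake linkage is load-bearing (a unitary family with a boundary ZERO).** Witness:
`n = m = 1`, `F = ℚ`, `α_w = {-1}`, `β_w = {1}`, `s₀ = 1` (off `X`, since `-1 ≠ 1` at every place):
`L(s) = ∏_{p ∉ S} (1 + p^{-s})⁻¹ = ζ^S(2s) / ζ^S(s) → ζ^S(2) · 0 / res = 0` as `s → 1⁺`
(`tprod_onePlus_mul_zeta`, the pole `tendsto_sub_one_mul_tprod_eulerFactor_one_numberField`, and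
continuity of `ζ_ℚ` at `2` through `tprod_eulerFactor_one_eq_dedekindZetaCont_mul_prod`), so no
non-zero limit exists. The non-vanishing half of the crux is automorphic input. -/
theorem pairLBoundaryJS_false_without_satakeLink : ¬ PairLBoundaryJSWithoutSatakeLink := by
  intro h
  haveI := infinite_heightOneSpectrum ℚ
  obtain ⟨S, hS, hmain⟩ := h 1 1 ℚ one_pos one_pos
  have hX : ¬ ((1 : ℕ) = 1 ∧ ∀ᶠ w : HeightOneSpectrum (𝓞 ℚ) in cofinite,
      ((fun _ => ({-1} : Multiset ℂ)) w).map ((((w.residueCard : ℂ) ^ (1 - (1 : ℂ)))) * ·) =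
        ((fun _ => ({1} : Multiset ℂ)) w).map (·⁻¹)) := by
    rintro ⟨-, hev⟩
    have hfalse : ∀ᶠ _w : HeightOneSpectrum (𝓞 ℚ) in cofinite, False := by
      filter_upwards [hev] with w hw
      simp only [sub_self, Complex.cpow_zero, one_mul, Multiset.map_singleton, inv_one,
        Multiset.singleton_inj] at hw
      norm_num at hw
    obtain ⟨_, hF⟩ := hfalse.exists
    exact hF
  obtain ⟨c, hc, hlim⟩ := hmain hS subset_rfl (α := fun _ => ({-1} : Multiset ℂ))
    (β := fun _ => ({1} : Multiset ℂ)) (fun w _ => by simp) (fun w _ => by simp)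
    (fun w _ => by simp) (fun w _ => by simp) Complex.one_re hX
  -- the function is `P(s) = ∏' (1 + q^{-s})⁻¹`
  set P : ℂ → ℂ := fun s => ∏' w : {w : HeightOneSpectrum (𝓞 ℚ) // w ∉ S},
    (1 + ((w.1.residueCard : ℂ) ^ (-s)))⁻¹ with hPdef
  set Z : ℂ → ℂ := fun s => ∏' w : {w : HeightOneSpectrum (𝓞 ℚ) // w ∉ S},
    (1 - ((w.1.residueCard : ℂ) ^ (-s)))⁻¹ with hZdef
  have hfun : (fun s : ℂ => ∏' w : {w : HeightOneSpectrum (𝓞 ℚ) // w ∉ S},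
      ((satakePairPolynomial ((fun _ => ({-1} : Multiset ℂ)) w.1)
        ((fun _ => ({1} : Multiset ℂ)) w.1)).eval ((w.1.residueCard : ℂ) ^ (-s)))⁻¹) = P := by
    funext s
    refine tprod_congr fun w => ?_
    rw [eval_pair_singleton]
    ring_nf
  rw [hfun] at hlim
  -- pole of `Z = ζ_ℚ^S` at `1`
  obtain ⟨c', hc', hpole⟩ := tendsto_sub_one_mul_tprod_eulerFactor_one_numberField (K := ℚ) hS
  -- continuity of `s ↦ Z (2s)` at `1`, through `ζ_ℚ`
  classical
  set E : ℂ → ℂ := fun s => ∏ v ∈ hS.toFinset, (1 - ((v.residueCard : ℂ) ^ (-s))) with hEdef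
  have hcontH := Literature.NumberTheory.LFunctions.NumberField.exists_isDedekindZetaContinuation_holds ℚ
  have hζdiff := Literature.NumberTheory.LFunctions.differentiableOn_dedekindZetaCont_of_exists ℚ hcontH
  have h2ne : (2 : ℂ) * 1 ≠ 1 := by norm_num
  have hG : ContinuousAt (fun s : ℂ =>
      Literature.NumberTheory.LFunctions.dedekindZetaCont ℚ (2 * s) * E (2 * s)) 1 := by
    have h2 : Continuous fun s : ℂ => 2 * s := continuous_const.mul continuous_id
    refine ContinuousAt.mul ?_ ?_
    · have hζ : ContinuousAt (Literature.NumberTheory.LFunctions.dedekindZetaCont ℚ) (2 * 1) :=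
        (hζdiff.differentiableAt (isOpen_compl_singleton.mem_nhds h2ne)).continuousAt
      exact ContinuousAt.comp (g := Literature.NumberTheory.LFunctions.dedekindZetaCont ℚ) hζ
        h2.continuousAt
    · have hE : Continuous E := by
        refine continuous_finsetProd _ fun v _ => continuous_one_sub_residueCard_cpow_neg v
      exact (hE.comp h2).continuousAt
  have hZ2 : Tendsto (fun s : ℂ => Z (2 * s)) (𝓝[{s : ℂ | 1 < s.re}] 1)
      (𝓝 (Literature.NumberTheory.LFunctions.dedekindZetaCont ℚ (2 * 1) * E (2 * 1))) := by
    refine (hG.tendsto.mono_left nhdsWithin_le_nhds).congr' ?_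
    filter_upwards [self_mem_nhdsWithin] with s hs
    have hs2 : 1 < (2 * s).re := by
      simp only [Complex.mul_re, Complex.re_ofNat, Complex.im_ofNat, zero_mul, sub_zero]
      have : 1 < s.re := hs
      linarith
    exact (tprod_eulerFactor_one_eq_dedekindZetaCont_mul_prod hS hs2).symm
  -- `P = Z(2s) · (s - 1) · ((s - 1) Z s)⁻¹` eventually, hence `P → 0`
  have hP0 : Tendsto P (𝓝[{s : ℂ | 1 < s.re}] 1) (𝓝 0) := by
    have hprod := (hZ2.mul tendsto_sub_one_nhdsWithin_one_lt_re).mul (hpole.inv₀ hc')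
    rw [mul_zero, zero_mul] at hprod
    refine hprod.congr' ?_
    filter_upwards [self_mem_nhdsWithin, hpole.eventually_ne hc'] with s hs hne
    have hs1 : 1 < s.re := hs
    have hZne : Z s ≠ 0 := by
      intro h0
      apply hne
      change (s - 1) * Z s = 0
      rw [h0, mul_zero]
    have hid : P s * Z s = Z (2 * s) := tprod_onePlus_mul_zeta S hs1
    have hs0 : s - 1 ≠ 0 := sub_ne_zero.2 fun h1 => by
      rw [h1, Complex.one_re] at hs1
      exact lt_irrefl _ hs1
    change Z (2 * s) * (s - 1) * ((s - 1) * Z s)⁻¹ = P s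
    rw [← hid]
    field_simp
  exact hc (tendsto_nhds_unique hlim hP0)


/-! ## (b) Hypothesis minimality: `0 < n` is decoration (checked); the rest informal (module doc) -/

/-- **`0 < n` is decoration.** In rank `n = 0` (any `m`, any `S`, any `s₀`, no unitarity, no `X`
clause) the crux's conclusion holds outright with `c = 1`: a Satake parameter of a rank-`0` datum has
`card = 0` (`HasSatakeParamAt.card_eq`), so `α w = 0`, every pair polynomial is the empty product
`1`, and `L^S ≡ 1`. (Symmetrically for `m = 0`.) So the guards `0 < n`, `0 < m` carry no content;
they only keep the statement inside the range where `CuspidalAutomorphicRepData` means something. -/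
theorem pairLBoundaryJS_rank_zero_left (m : ℕ) (F : Type) [Field F] [NumberField F]
    (hF : isCompact_glFiniteIntegralLevel 0 F) (hF' : isCompact_glFiniteIntegralLevel m F)
    (π : CuspidalAutomorphicRepData 0 F hF) (_π' : CuspidalAutomorphicRepData m F hF')
    {S : Set (HeightOneSpectrum (𝓞 F))} {α β : HeightOneSpectrum (𝓞 F) → Multiset ℂ}
    (hα : ∀ w ∉ S, π.1.HasSatakeParamAt w (α w)) (s₀ : ℂ) :
    ∃ c : ℂ, c ≠ 0 ∧ Tendsto (fun s : ℂ =>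
      ∏' w : {w : HeightOneSpectrum (𝓞 F) // w ∉ S},
        ((satakePairPolynomial (α w.1) (β w.1)).eval ((w.1.residueCard : ℂ) ^ (-s)))⁻¹)
      (𝓝[{s : ℂ | 1 < s.re}] s₀) (𝓝 c) := by
  refine ⟨1, one_ne_zero, ?_⟩
  have hfun : (fun s : ℂ => ∏' w : {w : HeightOneSpectrum (𝓞 F) // w ∉ S},
      ((satakePairPolynomial (α w.1) (β w.1)).eval ((w.1.residueCard : ℂ) ^ (-s)))⁻¹) =
      fun _ => 1 := by
    funext s
    have h1 : ∀ w : {w : HeightOneSpectrum (𝓞 F) // w ∉ S},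
        ((satakePairPolynomial (α w.1) (β w.1)).eval ((w.1.residueCard : ℂ) ^ (-s)))⁻¹ = 1 := by
      intro w
      have h0 : α w.1 = 0 := Multiset.card_eq_zero.1 (hα w.1 w.2).card_eq
      rw [h0, satakePairPolynomial, Multiset.zero_product, Multiset.map_zero, Multiset.prod_zero,
        Polynomial.eval_one, inv_one]
    rw [tprod_congr h1, tprod_one]
  rw [hfun]
  exact tendsto_const_nhds

/-! ## (d) Targets (lead's stuck stubs): none this cycle (`payload.stuck_stubs = []`).

Line `Sketch`: `PairLBoundaryJS_of := PairLBoundaryJS_of_moeglinWaldspurger_of_isOrtho hA hC hB` is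
kernel-checked sufficiency (p81600). The three crux-sized stubs are universally quantified Literature
facts (`MoeglinWaldspurger1989_partialPairL_entire_of_rank_ne`, `…_of_eq_conj`, orthogonal-pair
continuation); their only instantiable rank is `1`, where they are TRUE (tree: the `(1,1)` `L²` leaves
`…_at_one_of_ne_conj_one`, `…_boundary_of_ne_one_one`, `…_pole_of_eq_conj_one`). Nothing to break. -/

end Summit.Langlands.Langlands.Cruxes.PairLBoundaryJS.Disproof

end
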